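import Summits.QuantumFields.QCD.Theses.HeatSlicedQuarks
import Summits.QuantumFields.QCD.Theorems.HeatSlicedQuarksSmallFieldUltracontractivityStubFreeRowBounds
import Literature.MathematicalPhysics.QuantumLattice.LatticeToriProofs

/-!
# Stub `stub_freeWeightedMoments` of line `Sketch`
(crux `Summit.QuantumFields.QCD.Theses.HeatSlicedQuarks.InterleavedHeatSliceFlow`, item stmt-QuantumFields-8891)

**Free weighted moments** (reshape r4, input `FreeWeightedMoments` of `stub_columnIdentification`):
the three radial lattice sums of the free parabolic profiles against the comb weights `(d+3)`,
`(d+3)²` on the discrete four-torus `T_L = (ℤ/L)⁴`, `d = dist(x,z)` the periodic `ℓ^∞` distance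
and `s = 1 + σ ≥ 1`, uniformly in the side `L`:

* `Σ_z (d+3)² (s/(s+d²)³)² ≤ 1920/s`,
* `Σ_z (d+3)² (√s/(s+d²)³)² ≤ 1920/s²` (this is the first sum divided by `s`, termwise),
* `Σ_z (d+3) √s/(s+d²)³ ≤ 1920` (in fact `≤ 1728`).

Proof.  Radial summation against the sphere count `#{dist = r} ≤ 8(2r+1)³`
(`LatticeToriProofs.sum_radial_le`, `card_filter_torusDist_eq_le`) reduces everything to
one-dimensional sums over `r < L`.  For the first sum, `(2r+1)² ≤ 8(s+r²)`, `(r+3)² ≤ 10(s+r²)` and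
`s² ≤ (s+r²)²` give `8(2r+1)³(r+3)² s²/(s+r²)⁶ ≤ 640 (2r+1)/(s+r²)²`, and the telescoping bound
`Σ_r (2r+1)/(s+r²)² ≤ 3/s` of 8871 (`sum_range_linear_div_sq_le`, module `…StubFreeRowBounds`)
finishes.  For the third sum, with `a = √s ≥ 1`, `(2r+1)² ≤ 8(a²+r²)` and `(2r+1)(r+3) ≤ 9(a²+r²)`
give `8(2r+1)³(r+3) a/(a²+r²)³ ≤ 576 a/(a²+r²)`, and the telescoping bound
`Σ_r a/(a²+r²) ≤ 3` (from `(a+r)(a+r+1) ≤ 3(a²+r²)`, i.e.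
`a/(a²+r²) ≤ 3a (1/(a+r) − 1/(a+r+1))`) finishes.  Mathlib and the two cited tree lemmas only;
no named facts are used. [folklore]
-/

noncomputable section

namespace Summit.QuantumFields.QCD.Cruxes.InterleavedHeatSliceFlow.Sketch

open Literature.MathematicalPhysics.QuantumLattice Literature.MathematicalPhysics.QuantumFieldTheory
  Literature.Probability.LatticeModels
open Summit.QuantumFields.QCD.Theses.HeatSlicedQuarks
open Summit.QuantumFields.QCD.Cruxes.SmallFieldUltracontractivity.PointCentredAxialParabolic
  (sum_range_linear_div_sq_le)
open scoped Matrix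

/-! ### A one-dimensional telescoping sum -/

/-- Telescoping step: for `a ≥ 1` and `r : ℕ`, `a/(a²+r²) ≤ 3a (1/(a+r) - 1/(a+r+1))`, because
`(a+r)(a+r+1) ≤ 3(a²+r²)`. [folklore] -/
theorem freeWeightedMoments_telescope {a : ℝ} (ha : 1 ≤ a) (r : ℕ) :
    a / (a ^ 2 + (r : ℝ) ^ 2) ≤
      3 * a * (1 / (a + (r : ℝ)) - 1 / (a + ((r + 1 : ℕ) : ℝ))) := by
  have ha0 : 0 < a := by linarith
  have hr : (0 : ℝ) ≤ r := Nat.cast_nonneg r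
  have hrr : (r : ℝ) ≤ (r : ℝ) ^ 2 := by
    rcases Nat.eq_zero_or_pos r with h | h
    · simp [h]
    · have h1 : (1 : ℝ) ≤ r := by exact_mod_cast h
      nlinarith
  have hP : 0 < a ^ 2 + (r : ℝ) ^ 2 := by positivity
  have hQ : 0 < a + (r : ℝ) := by positivity
  have hR : 0 < a + ((r + 1 : ℕ) : ℝ) := by positivity
  have hkey : (a + (r : ℝ)) * (a + ((r + 1 : ℕ) : ℝ)) ≤ 3 * (a ^ 2 + (r : ℝ) ^ 2) := by
    push_cast
    nlinarith [sq_nonneg (a - r), mul_nonneg (sub_nonneg.2 ha) ha0.le]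
  rw [div_sub_div _ _ hQ.ne' hR.ne', one_mul, mul_one, mul_div_assoc',
    div_le_div_iff₀ hP (mul_pos hQ hR)]
  have h1 : a + ((r + 1 : ℕ) : ℝ) - (a + (r : ℝ)) = 1 := by push_cast; ring
  rw [h1, mul_one]
  nlinarith [mul_le_mul_of_nonneg_left hkey ha0.le]

/-- For `a ≥ 1`: `Σ_{r<N} a/(a²+r²) ≤ 3`, uniformly in `N` (telescoping). [folklore] -/
theorem freeWeightedMoments_sum_range_le {a : ℝ} (ha : 1 ≤ a) (N : ℕ) :
    ∑ r ∈ Finset.range N, a / (a ^ 2 + (r : ℝ) ^ 2) ≤ 3 := by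
  have ha0 : 0 < a := by linarith
  calc ∑ r ∈ Finset.range N, a / (a ^ 2 + (r : ℝ) ^ 2)
      ≤ ∑ r ∈ Finset.range N, 3 * a * (1 / (a + (r : ℝ)) - 1 / (a + ((r + 1 : ℕ) : ℝ))) :=
        Finset.sum_le_sum fun r _ => freeWeightedMoments_telescope ha r
    _ = 3 * a * (1 / (a + ((0 : ℕ) : ℝ)) - 1 / (a + (N : ℝ))) := by
        rw [← Finset.mul_sum, Finset.sum_range_sub' (fun n : ℕ => 1 / (a + (n : ℝ))) N]
    _ ≤ 3 * a * (1 / a) := by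
        have h0 : 0 ≤ 1 / (a + (N : ℝ)) := by positivity
        have h1 : 1 / (a + ((0 : ℕ) : ℝ)) = 1 / a := by simp
        rw [h1]
        exact mul_le_mul_of_nonneg_left (by linarith) (by positivity)
    _ = 3 := by
        field_simp

/-! ### Radial sums on the four-dimensional torus -/

/-- First weighted moment on `(ℤ/Lℤ)⁴`: for `s ≥ 1`, `Σ_z (d+3)² (s/(s+d²)³)² ≤ 1920/s`
(`d = dist(x,z)`), uniformly in `L`: sphere count `≤ 8(2r+1)³`, the pointwise bound
`8(2r+1)³(r+3)² s²/(s+r²)⁶ ≤ 640 (2r+1)/(s+r²)²`, and `Σ_r (2r+1)/(s+r²)² ≤ 3/s`. [folklore] -/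
theorem freeWeightedMoments_sum_sq_le {L : ℕ} [NeZero L] (x : TorusSite 4 L) {s : ℝ}
    (hs : 1 ≤ s) :
    ∑ z : TorusSite 4 L, ((torusDist x z : ℝ) + 3) ^ 2 *
        (s / (s + (torusDist x z : ℝ) ^ 2) ^ 3) ^ 2 ≤ 1920 / s := by
  have hs0 : 0 < s := by linarith
  set F : ℕ → ℝ := fun r => ((r : ℝ) + 3) ^ 2 * (s / (s + (r : ℝ) ^ 2) ^ 3) ^ 2 with hF
  have hF0 : ∀ r, 0 ≤ F r := fun r => by positivity
  have hrad := sum_radial_le (d := 4) F hF0 x (card_filter_torusDist_eq_le (by norm_num) x)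
    (fun u => torusDist_lt u x)
  calc ∑ z : TorusSite 4 L, ((torusDist x z : ℝ) + 3) ^ 2 *
        (s / (s + (torusDist x z : ℝ) ^ 2) ^ 3) ^ 2
      = ∑ z : TorusSite 4 L, F (torusDist z x) := by
        refine Finset.sum_congr rfl fun z _ => ?_
        rw [torusDist_comm' x z]
    _ ≤ ∑ r ∈ Finset.range L, ((4 * (2 * (2 * r + 1) ^ (4 - 1)) : ℕ) : ℝ) * F r := hrad
    _ ≤ ∑ r ∈ Finset.range L, 640 * ((2 * (r : ℝ) + 1) / (s + (r : ℝ) ^ 2) ^ 2) := by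
        refine Finset.sum_le_sum fun r _ => ?_
        have hr : (0 : ℝ) ≤ r := Nat.cast_nonneg r
        have hrr : (r : ℝ) ≤ (r : ℝ) ^ 2 := by
          rcases Nat.eq_zero_or_pos r with h | h
          · simp [h]
          · have h1 : (1 : ℝ) ≤ r := by exact_mod_cast h
            nlinarith
        have hP : 0 < s + (r : ℝ) ^ 2 := by positivity
        have h1 : (2 * (r : ℝ) + 1) ^ 2 ≤ 8 * (s + (r : ℝ) ^ 2) := by nlinarith
        have h2 : ((r : ℝ) + 3) ^ 2 ≤ 10 * (s + (r : ℝ) ^ 2) := by nlinarith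
        have h3 : s ^ 2 ≤ (s + (r : ℝ) ^ 2) ^ 2 :=
          pow_le_pow_left₀ hs0.le (le_add_of_nonneg_right (by positivity)) 2
        have hkey : (2 * (r : ℝ) + 1) ^ 2 * ((r : ℝ) + 3) ^ 2 * s ^ 2 ≤
            80 * (s + (r : ℝ) ^ 2) ^ 4 :=
          calc (2 * (r : ℝ) + 1) ^ 2 * ((r : ℝ) + 3) ^ 2 * s ^ 2
              ≤ 8 * (s + (r : ℝ) ^ 2) * (10 * (s + (r : ℝ) ^ 2)) * (s + (r : ℝ) ^ 2) ^ 2 :=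
                mul_le_mul (mul_le_mul h1 h2 (by positivity) (by positivity)) h3
                  (by positivity) (by positivity)
            _ = 80 * (s + (r : ℝ) ^ 2) ^ 4 := by ring
        have h8 : ((4 * (2 * (2 * r + 1) ^ (4 - 1)) : ℕ) : ℝ) = 8 * (2 * (r : ℝ) + 1) ^ 3 := by
          norm_num
          ring
        rw [h8, hF]
        dsimp only
        calc 8 * (2 * (r : ℝ) + 1) ^ 3 * (((r : ℝ) + 3) ^ 2 * (s / (s + (r : ℝ) ^ 2) ^ 3) ^ 2)
            = 8 * (2 * (r : ℝ) + 1) * ((2 * (r : ℝ) + 1) ^ 2 * ((r : ℝ) + 3) ^ 2 * s ^ 2) /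
                (s + (r : ℝ) ^ 2) ^ 6 := by
              field_simp
          _ ≤ 8 * (2 * (r : ℝ) + 1) * (80 * (s + (r : ℝ) ^ 2) ^ 4) / (s + (r : ℝ) ^ 2) ^ 6 := by
              gcongr
          _ = 640 * ((2 * (r : ℝ) + 1) / (s + (r : ℝ) ^ 2) ^ 2) := by
              field_simp
              ring
    _ = 640 * ∑ r ∈ Finset.range L, (2 * (r : ℝ) + 1) / (s + (r : ℝ) ^ 2) ^ 2 := by
        rw [Finset.mul_sum]
    _ ≤ 640 * (3 / s) := by gcongr; exact sum_range_linear_div_sq_le hs L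
    _ = 1920 / s := by ring

/-- Third weighted moment on `(ℤ/Lℤ)⁴`: for `a ≥ 1`, `Σ_z (d+3) a/(a²+d²)³ ≤ 1728`
(`d = dist(x,z)`), uniformly in `L`: sphere count `≤ 8(2r+1)³`, the pointwise bound
`8(2r+1)³(r+3) a/(a²+r²)³ ≤ 576 a/(a²+r²)`, and `Σ_r a/(a²+r²) ≤ 3`. [folklore] -/
theorem freeWeightedMoments_sum_sqrt_le {L : ℕ} [NeZero L] (x : TorusSite 4 L) {a : ℝ}
    (ha : 1 ≤ a) :
    ∑ z : TorusSite 4 L, ((torusDist x z : ℝ) + 3) *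
        (a / (a ^ 2 + (torusDist x z : ℝ) ^ 2) ^ 3) ≤ 1728 := by
  have ha0 : 0 < a := by linarith
  have ha2 : 1 ≤ a ^ 2 := by nlinarith
  set F : ℕ → ℝ := fun r => ((r : ℝ) + 3) * (a / (a ^ 2 + (r : ℝ) ^ 2) ^ 3) with hF
  have hF0 : ∀ r, 0 ≤ F r := fun r => by positivity
  have hrad := sum_radial_le (d := 4) F hF0 x (card_filter_torusDist_eq_le (by norm_num) x)
    (fun u => torusDist_lt u x)
  calc ∑ z : TorusSite 4 L, ((torusDist x z : ℝ) + 3) *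
        (a / (a ^ 2 + (torusDist x z : ℝ) ^ 2) ^ 3)
      = ∑ z : TorusSite 4 L, F (torusDist z x) := by
        refine Finset.sum_congr rfl fun z _ => ?_
        rw [torusDist_comm' x z]
    _ ≤ ∑ r ∈ Finset.range L, ((4 * (2 * (2 * r + 1) ^ (4 - 1)) : ℕ) : ℝ) * F r := hrad
    _ ≤ ∑ r ∈ Finset.range L, 576 * (a / (a ^ 2 + (r : ℝ) ^ 2)) := by
        refine Finset.sum_le_sum fun r _ => ?_
        have hr : (0 : ℝ) ≤ r := Nat.cast_nonneg r
        have hrr : (r : ℝ) ≤ (r : ℝ) ^ 2 := by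
          rcases Nat.eq_zero_or_pos r with h | h
          · simp [h]
          · have h1 : (1 : ℝ) ≤ r := by exact_mod_cast h
            nlinarith
        have hP : 0 < a ^ 2 + (r : ℝ) ^ 2 := by positivity
        have h1 : (2 * (r : ℝ) + 1) ^ 2 ≤ 8 * (a ^ 2 + (r : ℝ) ^ 2) := by nlinarith
        have h2 : (2 * (r : ℝ) + 1) * ((r : ℝ) + 3) ≤ 9 * (a ^ 2 + (r : ℝ) ^ 2) := by nlinarith
        have hkey : (2 * (r : ℝ) + 1) ^ 3 * ((r : ℝ) + 3) ≤ 72 * (a ^ 2 + (r : ℝ) ^ 2) ^ 2 :=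
          calc (2 * (r : ℝ) + 1) ^ 3 * ((r : ℝ) + 3)
              = (2 * (r : ℝ) + 1) ^ 2 * ((2 * (r : ℝ) + 1) * ((r : ℝ) + 3)) := by ring
            _ ≤ 8 * (a ^ 2 + (r : ℝ) ^ 2) * (9 * (a ^ 2 + (r : ℝ) ^ 2)) :=
                mul_le_mul h1 h2 (by positivity) (by positivity)
            _ = 72 * (a ^ 2 + (r : ℝ) ^ 2) ^ 2 := by ring
        have h8 : ((4 * (2 * (2 * r + 1) ^ (4 - 1)) : ℕ) : ℝ) = 8 * (2 * (r : ℝ) + 1) ^ 3 := by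
          norm_num
          ring
        rw [h8, hF]
        dsimp only
        calc 8 * (2 * (r : ℝ) + 1) ^ 3 * (((r : ℝ) + 3) * (a / (a ^ 2 + (r : ℝ) ^ 2) ^ 3))
            = 8 * ((2 * (r : ℝ) + 1) ^ 3 * ((r : ℝ) + 3)) * a / (a ^ 2 + (r : ℝ) ^ 2) ^ 3 := by
              ring
          _ ≤ 8 * (72 * (a ^ 2 + (r : ℝ) ^ 2) ^ 2) * a / (a ^ 2 + (r : ℝ) ^ 2) ^ 3 := by
              gcongr
          _ = 576 * (a / (a ^ 2 + (r : ℝ) ^ 2)) := by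
              field_simp
              ring
    _ = 576 * ∑ r ∈ Finset.range L, a / (a ^ 2 + (r : ℝ) ^ 2) := by
        rw [Finset.mul_sum]
    _ ≤ 576 * 3 := by gcongr; exact freeWeightedMoments_sum_range_le ha L
    _ = 1728 := by norm_num

/-! ### The stub -/

/-- **Free weighted moments** (registered stub `stub_freeWeightedMoments` of line `Sketch`,
reshape r4; the statement `FreeWeightedMoments` consumed by `stub_columnIdentification`): with
`d = dist(x,z)` the periodic `ℓ^∞` distance on `(ℤ/L)⁴` and `σ ≥ 0`, uniformly in `L`,
`Σ_z (d+3)² ((1+σ)/(1+σ+d²)³)² ≤ M/(1+σ)`, `Σ_z (d+3)² (√(1+σ)/(1+σ+d²)³)² ≤ M/(1+σ)²` and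
`Σ_z (d+3) √(1+σ)/(1+σ+d²)³ ≤ M`, with `M = 1920`.  Radial summation on the four-torus
(`freeWeightedMoments_sum_sq_le`, `freeWeightedMoments_sum_sqrt_le`); the second sum is the first
divided by `1+σ` termwise. [folklore] -/
theorem stub_freeWeightedMoments :
    ∃ M : ℝ, ∀ (L : ℕ) [NeZero L] (x : TorusSite 4 L) (σ : ℝ), 0 ≤ σ →
      (∑ z : TorusSite 4 L, ((torusDist x z : ℝ) + 3) ^ 2 *
          ((1 + σ) / (1 + σ + (torusDist x z : ℝ) ^ 2) ^ 3) ^ 2 ≤ M / (1 + σ)) ∧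
      (∑ z : TorusSite 4 L, ((torusDist x z : ℝ) + 3) ^ 2 *
          (Real.sqrt (1 + σ) / (1 + σ + (torusDist x z : ℝ) ^ 2) ^ 3) ^ 2 ≤ M / (1 + σ) ^ 2) ∧
      (∑ z : TorusSite 4 L, ((torusDist x z : ℝ) + 3) *
          (Real.sqrt (1 + σ) / (1 + σ + (torusDist x z : ℝ) ^ 2) ^ 3) ≤ M) := by
  refine ⟨1920, ?_⟩
  intro L _ x σ hσ
  have hs : (1 : ℝ) ≤ 1 + σ := by linarith
  have hs0 : (0 : ℝ) < 1 + σ := by linarith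
  have h1 := freeWeightedMoments_sum_sq_le x hs
  refine ⟨h1, ?_, ?_⟩
  · -- the second sum is the first divided by `1 + σ`, termwise
    have hterm : ∀ z : TorusSite 4 L, ((torusDist x z : ℝ) + 3) ^ 2 *
        (Real.sqrt (1 + σ) / (1 + σ + (torusDist x z : ℝ) ^ 2) ^ 3) ^ 2 =
        (1 / (1 + σ)) * (((torusDist x z : ℝ) + 3) ^ 2 *
          ((1 + σ) / (1 + σ + (torusDist x z : ℝ) ^ 2) ^ 3) ^ 2) := by
      intro z
      have hP : 0 < 1 + σ + (torusDist x z : ℝ) ^ 2 := by positivity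
      rw [div_pow, div_pow, Real.sq_sqrt hs0.le]
      field_simp
    calc ∑ z : TorusSite 4 L, ((torusDist x z : ℝ) + 3) ^ 2 *
          (Real.sqrt (1 + σ) / (1 + σ + (torusDist x z : ℝ) ^ 2) ^ 3) ^ 2
        = (1 / (1 + σ)) * ∑ z : TorusSite 4 L, ((torusDist x z : ℝ) + 3) ^ 2 *
            ((1 + σ) / (1 + σ + (torusDist x z : ℝ) ^ 2) ^ 3) ^ 2 := by
          rw [Finset.mul_sum]
          exact Finset.sum_congr rfl fun z _ => hterm z
      _ ≤ (1 / (1 + σ)) * (1920 / (1 + σ)) := by gcongr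
      _ = 1920 / (1 + σ) ^ 2 := by
          field_simp
  · -- the third sum, with `a = √(1+σ)`, `a² = 1 + σ`
    have ha : 1 ≤ Real.sqrt (1 + σ) := Real.one_le_sqrt.2 hs
    have ha2 : Real.sqrt (1 + σ) ^ 2 = 1 + σ := Real.sq_sqrt hs0.le
    have h3 := freeWeightedMoments_sum_sqrt_le x ha
    rw [ha2] at h3
    linarith

end Summit.QuantumFields.QCD.Cruxes.InterleavedHeatSliceFlow.Sketch

end
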